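import Summits.QuantumFields.YangMills.Theorems.BalabanUVNodesN08HaarCompatibilityGuardGeodesicConvex
import Summits.QuantumFields.YangMills.Theorems.BalabanUVNodesN08HaarCompatibilityGuardDefectOperatorNorm
import Summits.QuantumFields.YangMills.Theorems.BalabanUVNodesN08HaarCompatibilityGuardMonotonePairingSUN
import Mathlib.Analysis.Calculus.MeanValue
import Mathlib.Analysis.Calculus.Deriv.MeanValue
import Mathlib.Analysis.SpecialFunctions.Exponential

/-!
# BalabanUVNodes ∕ N08 — GLOBAL INJECTIVITY OF THE PRINTED exp-mean-log FIBRE MAP ON ITS GUARD SET FOR EVERY `N`, BY THE MONOTONE HEIGHT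
# (piece (iv) of the general-`N` port of n08-w3's part 30C; N-independent constants)

WIDTH SEAT `pub-ymgap-dag-n08-w6` g6 (R399 (3a); CLAIM-1 of record HOME INBOX l.38866), 2026-08-28.  Track A, DAG node N08 = [Balaban1985UV3] Thm 1
p. 257 (compact) + Thm 2 p. 272; [Balaban1987RG1] (0.4) p. 253 (the block average along one gauge fibre); key item K1⁷ `StabilityBAtRecordR13SepCoPH`
(stmt-QuantumFields-20542), `--supports … --as helper`.  COUNT-NEUTRAL.

THE MATHEMATICS ([folklore]).  `K(W) = Kmat h c W = exp(Σcᵢ log(hᵢW*))·W` on the guard set `G_δ = {W unitary : ∀ i ‖hᵢW* − 1‖ < δ}`, `δ ≤ 1∕3`.  Suppose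
`K u = K u′` on `G_δ`.  Part (i) (`…GuardGeodesicConvex.guard_geodesic`): `u′ = u·eˣ`, `x` skew, `‖x‖ < πδ`, and the geodesic `w_t = u·e^{tx}` stays in `G_δ`.
THE HEIGHT `F(t) = hs(X̃, K(w_t)·K(u)*)`, `X̃ = u x u*`, has `F(0) = F(1) = 0` (`K(u)K(u)* = 1`, `hs(X̃,1) = 0` for skew `X̃`) and derivative
`F′(t) = hs(X̃, D K_{w_t}(w_t x)·K(u)*)` (§2; pub-balaban's `hasStrictFDerivAt_Kmat`, `hasDerivAt_exp_smul_const`).  Since `D K_W(WX)·W* = dexp(Y)(H_Y − ΣcᵢHᵢ)`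
and `W·K(u)* = e^{−Y}·q_t`, `q_t = K(w_t)K(u)*` unitary, part (iii) (`…GuardMonotonePairingSUN.pairing_lower_bound`) and one Cauchy–Schwarz give
  `F′(t) ≥ (c₁ − κ·‖q_t − 1‖)·hs(x,x)`,   `c₁ = a₀λ − bK∕(4a₀)`, `κ = λ + b`, `λ = 1 − Σcᵢ`, `b = (Σcᵢ)ψ(ρ)`   (§1 `height_deriv_ge`; the hs-tools are part (iii)'s §4),
while part (ii) (`…GuardDefectOperatorNorm.norm_emlD_tangent_le`) bounds the DRIFT from both ends: `‖q_t − 1‖ ≤ min(t, 1 − t)·ν·‖x‖`, `ν = e^{sρ}(λ + ψ(sρ) + sψρ)`,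
`s = Σcᵢ` — in OPERATOR norm, uniformly in `N`.  Two applications of Lagrange (`[0,½]`, `[½,1]`) to `F ∓ …` give `c₁ ≤ κνπδ∕4` unless `x = 0`:
  ★★★ `kmat_injOn`:  under the CLOSING CONDITION `κ·ν·(πδ)∕4 < c₁` the printed fibre map is INJECTIVE on `G_δ` — for every `N`, every family `hᵢ`.
(30C: `N = 2` by quaternions, where Hilbert–Schmidt = operator norm; the closing condition is the same shape.)  The constants `ρ` (a bound for `‖log(hᵢW*)‖` on
`G_δ`), `a₀`, `K` are parameters; part (v) instantiates them at the typed guard.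

HONEST FRAMING.  Count-neutral helper ([folklore] calculus ∕ matrix analysis BY IMPORT); NO (H_K) ∕ density statement here; nothing of Bałaban's asserted; ONE RG
step — the k-uniform `hmass` is NOT supplied; E6′ NOT decided; N08 NOT discharged; counts unmoved (typed 28∕28 · discharged 5∕27); no summit statement is proved by
this seat — one finite 𝕋⁴ programme at fixed ε, R4 closes the CONDITIONAL rung `BalabanLadder.UV` only; the Yang–Mills mass gap (Clay) is NOT proved by any of this;
nothing continuum ∕ ℝ⁴ ∕ OS.  0 `sorry`, 0 `def`, 0 `instance`, 0 `notation`, standard axioms.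
-/

noncomputable section

open NormedSpace Finset Set
open scoped Matrix Matrix.Norms.L2Operator ComplexConjugate Nat

namespace Summit.QuantumFields.YangMills.BalabanUVNodes.N08HaarCompatibilityGuardMonotoneInjectiveSUN

open Literature.MathematicalPhysics.QuantumFieldTheory.Balaban1983to89
open Literature.MathematicalPhysics.QuantumFieldTheory.Balaban1983to89.T4EMLTangentInjective
open Summit.QuantumFields.YangMills.BalabanUVNodes.N08HaarCompatibilityGuardJacobian
open Summit.QuantumFields.YangMills.BalabanUVNodes.N08HaarCompatibilityGuardJacobianSharpFrame
open Summit.QuantumFields.YangMills.BalabanUVNodes.N08HaarCompatibilityGuardJacobianSharp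
open Summit.QuantumFields.YangMills.BalabanUVNodes.N08HaarCompatibilityGuardJacobianContractionFrame
open Summit.QuantumFields.YangMills.BalabanUVNodes.N08HaarCompatibilityGuardJacobianContractionOperator
open Summit.QuantumFields.YangMills.BalabanUVNodes.N08HaarCompatibilityGuardJacobianDet
open Summit.QuantumFields.YangMills.BalabanUVNodes.N08HaarCompatibilityGuardGeodesicConvex
open Summit.QuantumFields.YangMills.BalabanUVNodes.N08HaarCompatibilityGuardDefectOperatorNorm
open Summit.QuantumFields.YangMills.BalabanUVNodes.N08HaarCompatibilityGuardMonotonePairingSUN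
open Matrix (single diagonal unitaryGroup toEuclideanCLM)
open Complex (I)
open WithLp
open Literature.MathematicalPhysics.QuantumFieldTheory.Balaban1983to89.MatrixLog (mlog)
open T4QuatExpLog (ψ ψ_zero ψ_of_ne_zero)

variable {m : Type*} [Fintype m] [DecidableEq m] [Nonempty m] {ι : Type*} [Fintype ι]

/-! ## §1 The derivative of the height bounded below: pairing + Cauchy–Schwarz -/

/-- ★★ **THE HEIGHT'S DERIVATIVE, BOUNDED BELOW.**  For unitary `W` in the guard `‖hᵢW* − 1‖ < 1∕2`, `cᵢ ≥ 0`, `Σcᵢ ≤ 1`, skew `X`, a radius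
`‖log(hᵢW*)‖ ≤ ρ ≤ 1`, constants `0 < a₀`, `K` controlling the symbol `e^{−iβ}sinc β` on `|β| ≤ (Σcᵢ)ρ`, and ANY matrix `q`:
  `(a₀λ − bK∕(4a₀) − (λ + b)·‖q − 1‖)·hs(X, X) ≤ hs(WXW*, D K_W(WX)·W*·e^{−Y}·q)`,  `λ = 1 − Σcᵢ`, `b = (Σcᵢ)ψρ`, `Y = Σcᵢlog(hᵢW*)`.
PROOF.  `D K_W(WX)·W* = dexp Y (H_Y − ΣcᵢHᵢ)` (pub-balaban bookkeeping, `dexp Y` onto); `hs(A, M e^{−Y}) = hs(A e^{Y}, M)`; part (iii)'s pairing; the error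
`hs(X̃, P(q−1))` with `P = dexp Y(…)e^{−Y}`, `hs(P,P) ≤ (λ+b)²hs(X,X)` (g4 `hs_dexp_self_le`, `hs_symmetrised_self_le`) by Cauchy–Schwarz (part (iii) §4). [folklore] -/
theorem height_deriv_ge {h : ι → Matrix m m ℂ} (hh : ∀ i, h i ∈ unitaryGroup m ℂ) {W : Matrix m m ℂ}
    (hWu : W ∈ unitaryGroup m ℂ) (hg : ∀ i, ‖h i * star W - 1‖ < 1 / 2) {c : ι → ℝ} (hc0 : ∀ i, 0 ≤ c i)
    (hc1 : ∑ i, c i ≤ 1) {ρ : ℝ} (hρ0 : 0 ≤ ρ) (hρ : ∀ i, ‖mlog (h i * star W)‖ ≤ ρ) (hρ1 : ρ ≤ 1) {a₀ K : ℝ}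
    (ha₀ : 0 < a₀)
    (hre : ∀ β : ℝ, |β| ≤ (∑ i, c i) * ρ → a₀ ≤ (Complex.exp (-I * (β : ℂ)) * ((Real.sinc β : ℝ) : ℂ)).re)
    (hK : ∀ β : ℝ, |β| ≤ (∑ i, c i) * ρ → ‖Complex.exp (-I * (β : ℂ)) * ((Real.sinc β : ℝ) : ℂ) - a₀‖ ^ 2 ≤ K)
    (X : Matrix m m ℂ) (hX : Xᴴ = -X) (q : Matrix m m ℂ) :
    (a₀ * (1 - ∑ i, c i) - (∑ i, c i) * ψ ρ * K / (4 * a₀) - (1 - ∑ i, c i + (∑ i, c i) * ψ ρ) * ‖q - 1‖) * hs X X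
      ≤ hs (W * X * star W) (emlD h c W (W * X) * star W * exp (-∑ i, (c i : ℂ) • mlog (h i * star W)) * q) := by
  letI : NormedAlgebra ℚ (Matrix m m ℂ) := NormedAlgebra.restrictScalars ℚ ℂ (Matrix m m ℂ)
  have hW1 : star W * W = 1 := Matrix.mem_unitaryGroup_iff'.mp hWu
  have hW2 : W * star W = 1 := Matrix.mem_unitaryGroup_iff.mp hWu
  have hP1 : ∀ i, ‖h i * star W - 1‖ < 1 := fun i => lt_trans (hg i) (by norm_num)
  obtain ⟨hZskew, -, hYskew, hYn⟩ := guard_skew_norm hh hWu hg hc0 hc1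
  have hX' : star X = -X := by rw [Matrix.star_eq_conjTranspose, hX]
  set Y : Matrix m m ℂ := ∑ i, (c i : ℂ) • mlog (h i * star W) with hYdef
  set Xt : Matrix m m ℂ := W * X * star W with hXt
  set E : Matrix m m ℂ := emlD h c W (W * X)
  set H : ι → Matrix m m ℂ := fun i => fderiv ℂ mlog (h i * star W) (h i * star W * Xt)
  have hHi : ∀ i, dexp (mlog (h i * star W)) (H i) = exp (mlog (h i * star W)) * Xt := fun i => by
    show dexp (mlog (h i * star W)) (fderiv ℂ mlog (h i * star W) (h i * star W * Xt)) = _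
    rw [dexp_mlog_fderiv (hP1 i), MatrixLog.exp_mlog (hP1 i)]
  have hPX : ∀ i, h i * star (W * X) = -(h i * star W * Xt) := by
    intro i
    rw [star_mul, hX', neg_mul, mul_neg, hXt, show h i * star W * (W * X * star W)
      = h i * (star W * W) * (X * star W) by noncomm_ring, hW1, mul_one]
  have hE : E * star W = exp Y * Xt - dexp Y (∑ i, (c i : ℂ) • H i) := by
    have h0 : E = exp Y * (W * X) + dexp Y (∑ i, (c i : ℂ) • fderiv ℂ mlog (h i * star W) (h i * star (W * X))) * W :=
      emlD_apply h c W (W * X)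
    have h1 : (∑ i, (c i : ℂ) • fderiv ℂ mlog (h i * star W) (h i * star (W * X))) = -∑ i, (c i : ℂ) • H i := by
      rw [← Finset.sum_neg_distrib]
      exact Finset.sum_congr rfl fun i _ => by rw [hPX, map_neg, smul_neg]
    rw [h0, h1, map_neg, neg_mul, ← sub_eq_add_neg, hXt, sub_mul, mul_assoc, mul_assoc (dexp Y _) W (star W), hW2, mul_one]
  obtain ⟨G', hG'⟩ := (dexp_lower_bound_and_surjective hYskew one_pos (by linarith [Real.pi_gt_three]) hYn).2 (E * star W)
  have hY : dexp Y (G' + ∑ i, (c i : ℂ) • H i) = exp Y * Xt := by rw [map_add, hG', hE]; abel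
  -- the pairing (part (iii)) and the size of `G'` (g4)
  have hρY : ∑ i, c i * ρ ≤ (∑ i, c i) * ρ := (Finset.sum_mul _ _ _).symm.le
  have hpair := pairing_lower_bound hZskew (fun _ => ρ) hρ (fun _ => hρ1) c hc0 hc1 hρY ha₀ hre hK Xt H _ hHi hY
  have hGG := hs_symmetrised_self_le hZskew (fun _ => ρ) hρ (fun _ => hρ1) c hc0 hc1 Xt H _ hHi hY
  rw [add_sub_cancel_right] at hpair hGG
  rw [hG'] at hpair
  -- `P := (E W*)·e^{−Y}`; `e^{−Y} = (e^{Y})ᴴ` and `e^{Y}` is unitary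
  have hexpY : star (exp Y) = exp (-Y) := by rw [star_exp, Matrix.star_eq_conjTranspose, hYskew]
  have hexpYu : star (exp Y) * exp Y = 1 := by
    have := NormedSpace.exp_mem_unitary_of_mem_skewAdjoint (skewAdjoint.mem_iff.mpr (by rw [Matrix.star_eq_conjTranspose, hYskew]) : Y ∈ _)
    exact Unitary.star_mul_self_of_mem this
  have hXX : hs Xt Xt = hs X X := by rw [hXt]; exact hs_conj hW1 X X
  set P : Matrix m m ℂ := E * star W * exp (-Y) with hP
  have hmain : hs Xt P = hs (Xt * exp Y) (E * star W) := by rw [hP]; exact hs_mul_exp_neg Xt (E * star W) hYskew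
  have hPP : hs P P ≤ (1 - ∑ i, c i + (∑ i, c i) * ψ ρ) ^ 2 * hs X X := by
    have e1 : hs P P = hs (E * star W) (E * star W) := by rw [hP, ← hexpY]; exact hs_mul_star_unitary hexpYu _ _
    have e2 : (1 - ∑ i, c i * (1 - ψ ρ)) = (1 - ∑ i, c i + (∑ i, c i) * ψ ρ) := by
      have e3 : ∑ i, c i * (1 - ψ ρ) = ∑ i, c i - (∑ i, c i) * ψ ρ := by
        rw [Finset.sum_mul, ← Finset.sum_sub_distrib]; exact Finset.sum_congr rfl fun i _ => by ring
      rw [e3]; ring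
    rw [e1, ← hG', ← e2, ← hXX]
    exact (hs_dexp_self_le hYskew hYn G').trans hGG
  -- Cauchy–Schwarz on the error `hs(Xt, P(q − 1))`
  have hsplit : hs Xt (E * star W * exp (-Y) * q) = hs Xt P + hs Xt (P * (q - 1)) := by
    rw [← hs_add_right, Matrix.mul_sub, Matrix.mul_one, add_sub_cancel, hP]
  have hκ0 : 0 ≤ 1 - ∑ i, c i + (∑ i, c i) * ψ ρ := by
    have hψ : 0 ≤ ψ ρ := ψ_nonneg_of_abs_lt_pi (by rw [abs_of_nonneg hρ0]; linarith [Real.pi_gt_three])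
    have hs0 : 0 ≤ ∑ i, c i := Finset.sum_nonneg fun i _ => hc0 i
    nlinarith
  have herr : -((1 - ∑ i, c i + (∑ i, c i) * ψ ρ) * ‖q - 1‖ * hs X X) ≤ hs Xt (P * (q - 1)) := by
    have h1 := hs_mul_self_le Xt (P * (q - 1))
    have h2 : hs (P * (q - 1)) (P * (q - 1)) ≤ ‖q - 1‖ ^ 2 * ((1 - ∑ i, c i + (∑ i, c i) * ψ ρ) ^ 2 * hs X X) :=
      (hs_mul_self_le_opNorm_right P (q - 1)).trans (mul_le_mul_of_nonneg_left hPP (sq_nonneg _))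
    rw [hXX] at h1
    have hXX0 := hs_self_nonneg X
    have h3 : hs Xt (P * (q - 1)) ^ 2 ≤ ((1 - ∑ i, c i + (∑ i, c i) * ψ ρ) * ‖q - 1‖ * hs X X) ^ 2 := by
      nlinarith
    exact (abs_le_of_sq_le_sq' h3 (by positivity)).1
  -- assemble
  rw [hsplit, hmain]
  rw [hXX, ← Finset.sum_mul] at hpair
  linarith

/-! ## §2 Calculus along the geodesic -/

omit [Nonempty m] [Fintype ι] in
/-- The geodesic `s ↦ u₀·exp(s·x)` has derivative `u₀·exp(t·x)·x`. [folklore] -/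
theorem hasDerivAt_path (u₀ x : Matrix m m ℂ) (t : ℝ) :
    HasDerivAt (fun s : ℝ => u₀ * exp ((s : ℂ) • x)) (u₀ * exp ((t : ℂ) • x) * x) t := by
  have h1 : HasDerivAt (fun s : ℝ => exp ((s : ℂ) • x)) (exp ((t : ℂ) • x) * x) t := by
    have := hasDerivAt_exp_smul_const (𝕂 := ℝ) x t
    simp only [RCLike.real_smul_eq_coe_smul (K := ℂ)] at this
    exact this
  simpa only [Matrix.mul_assoc] using h1.const_mul u₀

omit [Nonempty m] [Fintype ι] in
/-- `s ↦ hs A (g s)` has derivative `hs A g′` (a real-linear functional of `g`). [folklore] -/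
theorem hasDerivAt_hs_comp {g : ℝ → Matrix m m ℂ} {g' : Matrix m m ℂ} (A : Matrix m m ℂ) {t : ℝ} (hg : HasDerivAt g g' t) :
    HasDerivAt (fun s => hs A (g s)) (hs A g') t := by
  let L : Matrix m m ℂ →L[ℝ] ℝ := Complex.reCLM.comp
    ((LinearMap.toContinuousLinearMap ((Matrix.traceLinearMap m ℂ ℂ).comp (LinearMap.mulLeft ℂ Aᴴ))).restrictScalars ℝ)
  have hL : ∀ M, L M = hs A M := fun M => by
    simp only [L, ContinuousLinearMap.coe_comp, Function.comp_apply, ContinuousLinearMap.coe_restrictScalars',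
      LinearMap.coe_toContinuousLinearMap', LinearMap.coe_comp, Matrix.traceLinearMap_apply, LinearMap.mulLeft_apply,
      Complex.reCLM_apply]
    rfl
  have := L.hasFDerivAt.comp_hasDerivAt t hg
  simpa only [Function.comp_def, hL] using this

/-- `s ↦ K(u₀·exp(s·x))` has derivative `D K_{w}(w·x)`, `w = u₀e^{tx}`, on the guard `‖hᵢw* − 1‖ < 1`. [folklore] -/
theorem hasDerivAt_kmat_path (h : ι → Matrix m m ℂ) (c : ι → ℝ) (u₀ x : Matrix m m ℂ) {t : ℝ}
    (hg : ∀ i, ‖h i * star (u₀ * exp ((t : ℂ) • x)) - 1‖ < 1) :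
    HasDerivAt (fun s : ℝ => Kmat h c (u₀ * exp ((s : ℂ) • x)))
      (emlD h c (u₀ * exp ((t : ℂ) • x)) (u₀ * exp ((t : ℂ) • x) * x)) t := by
  have h1 := (hasStrictFDerivAt_Kmat h c hg).hasFDerivAt.comp_hasDerivAt t (hasDerivAt_path u₀ x t)
  exact h1

omit [Fintype m] [DecidableEq m] [Nonempty m] [Fintype ι] in
/-- Lagrange: a function with a nonnegative derivative on `[a,b]` does not decrease. [folklore] -/
theorem le_of_hasDerivAt_nonneg {f f' : ℝ → ℝ} {a b : ℝ} (hab : a < b) (hf : ∀ t ∈ Icc a b, HasDerivAt f (f' t) t)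
    (hpos : ∀ t ∈ Icc a b, 0 ≤ f' t) : f a ≤ f b := by
  have hcont : ContinuousOn f (Icc a b) := fun t ht => (hf t ht).continuousAt.continuousWithinAt
  obtain ⟨ξ, hξ, hslope⟩ := exists_hasDerivAt_eq_slope f f' hab hcont (fun t ht => hf t (Ioo_subset_Icc_self ht))
  have h1 : 0 ≤ (f b - f a) / (b - a) := hslope ▸ hpos ξ (Ioo_subset_Icc_self hξ)
  have h2 : 0 < b - a := by linarith
  have := (div_nonneg_iff.mp h1)
  rcases this with ⟨h3, -⟩ | ⟨-, h4⟩
  · linarith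
  · linarith

/-! ## §3 GLOBAL INJECTIVITY ON THE GUARD SET -/

/-- ★★★ **GLOBAL INJECTIVITY OF THE PRINTED exp-mean-log FIBRE MAP ON ITS GUARD SET, EVERY `N`.**  Unitaries `hᵢ`, weights `cᵢ ≥ 0`, `Σcᵢ ≤ 1`,
a guard radius `δ ≤ 1∕3`, a radius `ρ ≤ 1` with `‖log(hᵢW*)‖ ≤ ρ` on the guard set, constants `0 < a₀`, `K` controlling the symbol `e^{−iβ}sinc β` on
`|β| ≤ (Σcᵢ)ρ`, and the CLOSING CONDITION `κ·ν·(πδ)∕4 < c₁` (`λ = 1 − Σcᵢ`, `b = (Σcᵢ)ψρ`, `κ = λ + b`, `ν = e^{(Σcᵢ)ρ}(λ + ψ((Σcᵢ)ρ) + b)`,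
`c₁ = a₀λ − bK∕(4a₀)`).  Then `W ↦ K(W) = exp(Σcᵢlog(hᵢW*))·W` is injective on `{W unitary : ∀ i ‖hᵢW* − 1‖ < δ}`.
PROOF.  The monotone height (module docstring): `F(0) = F(1) = 0`, `F′ ≥ (c₁ − κ‖q_t − 1‖)·hs(x,x)`, `‖q_t − 1‖ ≤ min(t,1−t)·ν‖x‖`, `‖x‖ < πδ`; Lagrange on
`[0,½]` and `[½,1]` gives `(c₁ − κν‖x‖∕4)·hs(x,x) ≤ 0`, so `x = 0`, `u′ = u`. [folklore] -/
theorem kmat_injOn {h : ι → Matrix m m ℂ} (hh : ∀ i, h i ∈ unitaryGroup m ℂ) {c : ι → ℝ} (hc0 : ∀ i, 0 ≤ c i)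
    (hc1 : ∑ i, c i ≤ 1) {δ : ℝ} (hδ : δ ≤ 1 / 3) {ρ : ℝ} (hρ0 : 0 ≤ ρ) (hρ1 : ρ ≤ 1)
    (hρ : ∀ W : Matrix m m ℂ, W ∈ unitaryGroup m ℂ → (∀ i, ‖h i * star W - 1‖ < δ) → ∀ i, ‖mlog (h i * star W)‖ ≤ ρ)
    {a₀ K : ℝ} (ha₀ : 0 < a₀)
    (hre : ∀ β : ℝ, |β| ≤ (∑ i, c i) * ρ → a₀ ≤ (Complex.exp (-I * (β : ℂ)) * ((Real.sinc β : ℝ) : ℂ)).re)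
    (hK : ∀ β : ℝ, |β| ≤ (∑ i, c i) * ρ → ‖Complex.exp (-I * (β : ℂ)) * ((Real.sinc β : ℝ) : ℂ) - a₀‖ ^ 2 ≤ K)
    (hclose : (1 - ∑ i, c i + (∑ i, c i) * ψ ρ)
        * (Real.exp ((∑ i, c i) * ρ) * (1 - ∑ i, c i + ψ ((∑ i, c i) * ρ) + (∑ i, c i) * ψ ρ)) * (Real.pi * δ) / 4
        < a₀ * (1 - ∑ i, c i) - (∑ i, c i) * ψ ρ * K / (4 * a₀)) :
    Set.InjOn (Kmat h c) {W | W ∈ unitaryGroup m ℂ ∧ ∀ i, ‖h i * star W - 1‖ < δ} := by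
  letI : NormedAlgebra ℚ (Matrix m m ℂ) := NormedAlgebra.restrictScalars ℚ ℂ (Matrix m m ℂ)
  intro u hu u' hu' heq
  rcases isEmpty_or_nonempty ι with hι | ⟨⟨i₀⟩⟩
  · have hK0 : ∀ W : Matrix m m ℂ, Kmat h c W = W := fun W => by simp [Kmat]
    simpa [hK0] using heq
  obtain ⟨x, hx, hux, hxle, hpath⟩ := guard_geodesic hh hu.1 hu'.1 (by linarith) hu.2 hu'.2
  have hΘ : ‖x‖ < Real.pi * δ := by
    have := norm_sub_lt_two_mul_of_guard (hh i₀) (hu.2 i₀) (hu'.2 i₀)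
    nlinarith [Real.pi_pos]
  -- abbreviations
  set sc : ℝ := ∑ i, c i with hsc
  set κ : ℝ := 1 - sc + sc * ψ ρ with hκ
  set ν : ℝ := Real.exp (sc * ρ) * (1 - sc + ψ (sc * ρ) + sc * ψ ρ) with hν
  set c₁ : ℝ := a₀ * (1 - sc) - sc * ψ ρ * K / (4 * a₀) with hc₁
  set D : ℝ := hs x x with hD
  have hD0 : 0 ≤ D := hs_self_nonneg x
  have hψρ : 0 ≤ ψ ρ := ψ_nonneg_of_abs_lt_pi (by rw [abs_of_nonneg hρ0]; linarith [Real.pi_gt_three])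
  have hsc0 : 0 ≤ sc := Finset.sum_nonneg fun i _ => hc0 i
  have hκ0 : 0 ≤ κ := by rw [hκ]; nlinarith
  have hν0 : 0 ≤ ν := by
    rw [hν]
    refine mul_nonneg (Real.exp_pos _).le ?_
    have : 0 ≤ ψ (sc * ρ) := ψ_nonneg_of_abs_lt_pi (by
      rw [abs_of_nonneg (mul_nonneg hsc0 hρ0)]; nlinarith [Real.pi_gt_three])
    nlinarith
  set w : ℝ → Matrix m m ℂ := fun t => u * exp ((t : ℂ) • x) with hw
  set Xt : Matrix m m ℂ := u * x * star u with hXt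
  set Cu : Matrix m m ℂ := star (Kmat h c u) with hCu
  set q : ℝ → Matrix m m ℂ := fun t => Kmat h c (w t) * Cu with hq
  set F : ℝ → ℝ := fun t => hs Xt (q t) with hF
  -- along the geodesic
  have hwu : ∀ t ∈ Icc (0 : ℝ) 1, w t ∈ unitaryGroup m ℂ := fun t ht => (hpath t ht).1
  have hwg : ∀ t ∈ Icc (0 : ℝ) 1, ∀ i, ‖h i * star (w t) - 1‖ < 1 / 2 := fun t ht i => ((hpath t ht).2 i).trans_le (by linarith)
  have hwg1 : ∀ t ∈ Icc (0 : ℝ) 1, ∀ i, ‖h i * star (w t) - 1‖ < 1 := fun t ht i => (hwg t ht i).trans (by norm_num)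
  have hu1 : star u * u = 1 := Matrix.mem_unitaryGroup_iff'.mp hu.1
  have hu2 : u * star u = 1 := Matrix.mem_unitaryGroup_iff.mp hu.1
  have hKu : Kmat h c u ∈ unitaryGroup m ℂ := kmat_mem_unitaryGroup hh hu.1 (fun i => (hu.2 i).trans_le (by linarith)) c
  have hKu2 : Kmat h c u * Cu = 1 := Matrix.mem_unitaryGroup_iff.mp hKu
  have hXtskew : Xtᴴ = -Xt := by
    rw [hXt, Matrix.conjTranspose_mul, Matrix.conjTranspose_mul, hx, ← Matrix.star_eq_conjTranspose, ← Matrix.star_eq_conjTranspose,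
      star_star]; noncomm_ring
  have hw0 : w 0 = u := by simp [hw]
  have hw1 : w 1 = u' := by simp [hw, hux]
  have hF0 : F 0 = 0 := by simp only [hF, hq, hw0, hKu2]; exact hs_one_of_skew hXtskew
  have hF1 : F 1 = 0 := by simp only [hF, hq, hw1, ← heq, hKu2]; exact hs_one_of_skew hXtskew
  -- derivatives
  have hderq : ∀ t ∈ Icc (0 : ℝ) 1, HasDerivAt q (emlD h c (w t) (w t * x) * Cu) t := fun t ht =>
    (hasDerivAt_kmat_path h c u x (hwg1 t ht)).mul_const Cu
  have hderF : ∀ t ∈ Icc (0 : ℝ) 1, HasDerivAt F (hs Xt (emlD h c (w t) (w t * x) * Cu)) t := fun t ht =>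
    hasDerivAt_hs_comp Xt (hderq t ht)
  -- the drift, from both ends (part (ii), operator norm)
  have hE : ∀ t ∈ Icc (0 : ℝ) 1, ‖emlD h c (w t) (w t * x) * Cu‖ ≤ ν * ‖x‖ := by
    intro t ht
    rw [CStarRing.norm_mul_mem_unitary _ (Unitary.star_mem hKu)]
    have := norm_emlD_tangent_le hh (hwu t ht) (hwg t ht) hc0 hc1 (fun _ => ρ) (hρ (w t) (hwu t ht) (hpath t ht).2)
      (fun _ => hρ1) x hx
    rw [← Finset.sum_mul, ← Finset.sum_mul] at this
    exact this
  have hdrift0 : ∀ t ∈ Icc (0 : ℝ) 1, ‖q t - 1‖ ≤ ν * ‖x‖ * t := by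
    intro t ht
    have h0 : q 0 = 1 := by simp only [hq, hw0, hKu2]
    have := norm_image_sub_le_of_norm_deriv_le_segment' (f := q) (a := 0) (b := 1)
      (fun s hs => (hderq s hs).hasDerivWithinAt) (fun s hs => hE s (Ico_subset_Icc_self hs)) t ht
    rwa [h0, sub_zero] at this
  have hdrift1 : ∀ t ∈ Icc (0 : ℝ) 1, ‖q t - 1‖ ≤ ν * ‖x‖ * (1 - t) := by
    intro t ht
    have h1 : q 1 = 1 := by simp only [hq, hw1, ← heq, hKu2]
    have := norm_image_sub_le_of_norm_deriv_le_segment' (f := q) (a := t) (b := 1)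
      (fun s hs => (hderq s ⟨ht.1.trans hs.1, hs.2⟩).hasDerivWithinAt)
      (fun s hs => hE s ⟨ht.1.trans hs.1, hs.2.le⟩) 1 ⟨ht.2, le_rfl⟩
    rwa [h1, norm_sub_rev] at this
  -- the derivative bound (§2) at each point of the geodesic
  have hF' : ∀ t ∈ Icc (0 : ℝ) 1, (c₁ - κ * ‖q t - 1‖) * D ≤ hs Xt (emlD h c (w t) (w t * x) * Cu) := by
    intro t ht
    have hwt1 : star (w t) * w t = 1 := Matrix.mem_unitaryGroup_iff'.mp (hwu t ht)
    have key := height_deriv_ge hh (hwu t ht) (hwg t ht) hc0 hc1 hρ0 (hρ (w t) (hwu t ht) (hpath t ht).2) hρ1 ha₀ hre hK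
      x hx (q t)
    -- `w_t x w_t* = u x u*` and `E·Cu = E·w_t*·e^{−Y}·q_t`
    have hcomm : exp ((t : ℂ) • x) * x = x * exp ((t : ℂ) • x) := ((Commute.refl x).smul_left (t : ℂ)).exp_left.eq
    have hXw : w t * x * star (w t) = Xt := by
      have e1 : star (w t) = exp (-((t : ℂ) • x)) * star u := by
        simp only [hw, star_mul, star_exp, star_real_smul_skew hx]
      have e2 : exp ((t : ℂ) • x) * x * exp (-((t : ℂ) • x)) = x := by
        rw [hcomm, Matrix.mul_assoc, ← exp_add_of_commute (Commute.refl _).neg_right, add_neg_cancel, exp_zero, Matrix.mul_one]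
      calc w t * x * star (w t) = u * (exp ((t : ℂ) • x) * x * exp (-((t : ℂ) • x))) * star u := by
            rw [e1]; simp only [hw, Matrix.mul_assoc]
        _ = Xt := by rw [e2]
    have hfac : emlD h c (w t) (w t * x) * Cu
        = emlD h c (w t) (w t * x) * star (w t) * exp (-∑ i, (c i : ℂ) • mlog (h i * star (w t))) * q t := by
      have e3 : exp (-∑ i, (c i : ℂ) • mlog (h i * star (w t))) * exp (∑ i, (c i : ℂ) • mlog (h i * star (w t))) = 1 := by
        rw [← exp_add_of_commute (Commute.refl _).neg_left, neg_add_cancel, exp_zero]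
      have e4 : q t = exp (∑ i, (c i : ℂ) • mlog (h i * star (w t))) * w t * Cu := rfl
      rw [e4]
      calc emlD h c (w t) (w t * x) * Cu = emlD h c (w t) (w t * x) * (star (w t) * w t) * Cu := by rw [hwt1, Matrix.mul_one]
        _ = emlD h c (w t) (w t * x) * (star (w t) * (exp (-∑ i, (c i : ℂ) • mlog (h i * star (w t)))
              * exp (∑ i, (c i : ℂ) • mlog (h i * star (w t)))) * w t) * Cu := by rw [e3, Matrix.mul_one]
        _ = _ := by simp only [Matrix.mul_assoc]
    rw [hfac, ← hXw]
    refine le_trans (le_of_eq ?_) key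
    rw [hc₁, hκ, hD]
  -- Lagrange on `[0, ½]`: `F(½) ≥ c₁D/2 − κν‖x‖D/8`
  set A : ℝ := κ * (ν * ‖x‖) * D with hA
  have hA0 : 0 ≤ A := by rw [hA]; positivity
  have hG1 : ∀ t ∈ Icc (0 : ℝ) 1, HasDerivAt (fun s => F s - c₁ * D * s + A / 2 * (s * s))
      (hs Xt (emlD h c (w t) (w t * x) * Cu) - c₁ * D * 1 + A / 2 * (1 * t + t * 1)) t := fun t ht =>
    ((hderF t ht).sub ((hasDerivAt_id' t).const_mul (c₁ * D))).add (((hasDerivAt_id' t).mul (hasDerivAt_id' t)).const_mul (A / 2))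
  have hG1pos : ∀ t ∈ Icc (0 : ℝ) 1, 0 ≤ hs Xt (emlD h c (w t) (w t * x) * Cu) - c₁ * D * 1 + A / 2 * (1 * t + t * 1) := by
    intro t ht
    have h1 := hF' t ht
    have h2 : κ * ‖q t - 1‖ * D ≤ A * t := by
      rw [hA]; have := hdrift0 t ht
      calc κ * ‖q t - 1‖ * D ≤ κ * (ν * ‖x‖ * t) * D := by gcongr
        _ = κ * (ν * ‖x‖) * D * t := by ring
    linarith
  have hhalf := le_of_hasDerivAt_nonneg (f := fun s => F s - c₁ * D * s + A / 2 * (s * s))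
    (f' := fun t => hs Xt (emlD h c (w t) (w t * x) * Cu) - c₁ * D * 1 + A / 2 * (1 * t + t * 1)) (a := 0) (b := 1 / 2)
    (by norm_num) (fun t ht => hG1 t ⟨ht.1, ht.2.trans (by norm_num)⟩) (fun t ht => hG1pos t ⟨ht.1, ht.2.trans (by norm_num)⟩)
  -- Lagrange on `[½, 1]`: `F(½) ≤ −c₁D/2 + κν‖x‖D/8`
  have hG2 : ∀ t ∈ Icc (0 : ℝ) 1, HasDerivAt (fun s => F s - c₁ * D * s - A / 2 * ((1 - s) * (1 - s)))
      (hs Xt (emlD h c (w t) (w t * x) * Cu) - c₁ * D * 1 - A / 2 * ((0 - 1) * (1 - t) + (1 - t) * (0 - 1))) t := fun t ht =>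
    ((hderF t ht).sub ((hasDerivAt_id' t).const_mul (c₁ * D))).sub
      ((((hasDerivAt_const t (1 : ℝ)).sub (hasDerivAt_id' t)).mul ((hasDerivAt_const t (1 : ℝ)).sub (hasDerivAt_id' t))).const_mul (A / 2))
  have hG2pos : ∀ t ∈ Icc (0 : ℝ) 1,
      0 ≤ hs Xt (emlD h c (w t) (w t * x) * Cu) - c₁ * D * 1 - A / 2 * ((0 - 1) * (1 - t) + (1 - t) * (0 - 1)) := by
    intro t ht
    have h1 := hF' t ht
    have h2 : κ * ‖q t - 1‖ * D ≤ A * (1 - t) := by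
      rw [hA]; have := hdrift1 t ht
      calc κ * ‖q t - 1‖ * D ≤ κ * (ν * ‖x‖ * (1 - t)) * D := by gcongr
        _ = κ * (ν * ‖x‖) * D * (1 - t) := by ring
    linarith
  have hhalf' := le_of_hasDerivAt_nonneg (f := fun s => F s - c₁ * D * s - A / 2 * ((1 - s) * (1 - s)))
    (f' := fun t => hs Xt (emlD h c (w t) (w t * x) * Cu) - c₁ * D * 1 - A / 2 * ((0 - 1) * (1 - t) + (1 - t) * (0 - 1)))
    (a := 1 / 2) (b := 1) (by norm_num)
    (fun t ht => hG2 t ⟨le_trans (by norm_num) ht.1, ht.2⟩) (fun t ht => hG2pos t ⟨le_trans (by norm_num) ht.1, ht.2⟩)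
  simp only [hF0, hF1] at hhalf hhalf'
  -- conclude
  have hc₁A : c₁ * D ≤ A / 4 := by linarith
  have hcl : κ * ν * (Real.pi * δ) / 4 < c₁ := by simpa only [hκ, hν, hc₁, hsc] using hclose
  have hD0' : D = 0 := by
    by_contra hne
    have hDpos : 0 < D := lt_of_le_of_ne hD0 (Ne.symm hne)
    have h1 : A / 4 ≤ κ * ν * (Real.pi * δ) / 4 * D := by
      rw [hA]
      have h3 : κ * (ν * ‖x‖) ≤ κ * ν * (Real.pi * δ) := by
        rw [← mul_assoc]; exact mul_le_mul_of_nonneg_left hΘ.le (mul_nonneg hκ0 hν0)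
      have h4 := mul_le_mul_of_nonneg_right h3 hD0
      linarith
    have h5 := mul_lt_mul_of_pos_right hcl hDpos
    linarith
  have hx0 : x = 0 := hs_self_eq_zero (by rw [← hD]; exact hD0')
  rw [← hux, hx0, exp_zero, Matrix.mul_one]

end Summit.QuantumFields.YangMills.BalabanUVNodes.N08HaarCompatibilityGuardMonotoneInjectiveSUN
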